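import Summits.BirchSwinnertonDyer.BirchSwinnertonDyer.Theorems.CongruentShaFreeCutBDPUpToRigidity
import Summits.BirchSwinnertonDyer.BirchSwinnertonDyer.Theorems.CongruentShaFreeCutCharacterSupply
import Summits.BirchSwinnertonDyer.Rank1Residual.X11b.Three.UnrSeriesTwist
import Summits.BirchSwinnertonDyer.Rank1Residual.X11b.BDPFrameUniqueness
import Summits.BirchSwinnertonDyer.Rank1Residual.Additive.PowerSeriesSubstEval
import Summits.BirchSwinnertonDyer.Rank1Residual.Additive.PowerMapSubstitution
import HarnessLib

set_option linter.dupNamespace false -- `Summit.BirchSwinnertonDyer.BirchSwinnertonDyer.Theorems.…` (summit = sub)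
set_option autoImplicit false

/-!
# Route `CongruentShaFreeCut` (rung S2) — LEMMA R∞, analytic step: two ♯-frames of the SAME
# `(ι, 𝔭, κ, γ, f)` satisfy the POWER-TYPE functional equation
# `(C'/C)^{p−1} · 𝓛'((1+T)^p−1) · 𝓛^p = 𝓛'^p · 𝓛((1+T)^p−1)` in `ℂ_p⟦T⟧`

Cell `bsd-cn100`, prover seat `bsd-cn100-transfer` (g11), plan g15 RULING-4 (2026-08-27T01:22:06Z)
«COMMISSIONED … LEMMA R∞ (series rigidity across periods)», file 4 (the analytic input of the algebraic
core `…CongruentShaFreeCutPowerMapSeriesRigidity.exists_C_pow_mul_eq_of_powerMap_identity`). Supports, does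
not close, stmt-BirchSwinnertonDyer-19079. THEOREMS ONLY; imports no `Theses` module. PARTITION: none —
RANK axis. HONEST FRAMING: nothing about any `L`-value is asserted; all statements are implications from the
typed frame `IsBDPLFunctionUpTo` (Castella 2018 Thm. 3.1 display, up to a constant).

WHY IT HOLDS. By `hasValueAt_frameUpTo_rescale` (file `…BDPUpToRigidity`), at an interpolation point of
infinity type `(n, −n)` the second frame's value is `A·β^n` times the first frame's value
(`A = C'/C`, `β = ι⁻¹((Ω_K/Ω'_K)⁴)(Ω'_p/Ω_p)⁴`). The character supply (`…CharacterSupply.characterSupplyAt`,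
every `p`) provides characters `φ_k` of type `m p^k` with avatar values `x₀^{p^k}` at `γ`,
`x₀^{p^k} → 1`, `x₀^{p^k} ≠ 1`; the point of `φ_{k+1}` is the image of the point of `φ_k` under the
`p`-power map `Φ(T) = (1+T)^p − 1`, and its type is `p` times that of `φ_k`. Hence at `T = x₀^{p^k} − 1` both
sides of the displayed identity take the value `A^p β^{p m p^k} 𝓛(x_{k+1}) 𝓛(x_k)^p`; the difference is a
series with bounded coefficients vanishing on a sequence accumulating at `0`, hence zero (identity principle,
`…X11b.powerSeries_eq_zero_of_hasSum_zero_of_tendsto_zero`). Evaluation commutes with the substitution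
`𝓛 ↦ 𝓛(Φ)` by b2b-bsdres's `…Additive.hasSum_map_coeff_subst_mul_pow`.

* §1 `powerMap_identity_of_values` — the abstract statement (values prescribed along a `Φ`-stable
  sequence with factors `A β^{n_k}`, `n_{k+1} = p n_k`).
* §2 **`powerMap_identity_of_isBDPLFunctionUpTo`** — the statement for two ♯-frames (`K` imaginary
  quadratic, `κ` anticyclotomic, `γ` a topological generator; `Ω`'s and `C`'s non-zero).

References: [Castella2018] Thm. 3.1; [Cassels1986] Ch. 4 (identity principle); [Washington1997] §7.2.
-/

noncomputable section

open scoped Classical Topology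

open Filter PowerSeries Literature.NumberTheory.EllipticCurves NumberField IsDedekindDomain
  Summit.BirchSwinnertonDyer.Rank1Residual.X11b
  Summit.BirchSwinnertonDyer.Rank1Residual.X11b.Halves
  Summit.BirchSwinnertonDyer.Rank1Residual.Additive
  Summit.BirchSwinnertonDyer.BirchSwinnertonDyer.Theorems.CongruentShaFreeCutBDPUpToRigidity
  Summit.BirchSwinnertonDyer.BirchSwinnertonDyer.Theorems.CongruentShaFreeCutCharacterSupply

namespace Summit.BirchSwinnertonDyer.BirchSwinnertonDyer.Theorems.CongruentShaFreeCutBDPUpToPowerMapIdentity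

variable {p : ℕ} [hp : Fact p.Prime]

/-! ### §1 Values of sums, powers and of `𝓛((1+T)^p − 1)`; the abstract identity -/

/-- Sum rule for values. [folklore] -/
theorem hasValueAt_add {L M : UnrSeries p} {x v w : ℂ_[p]} (hL : L.HasValueAt x v)
    (hM : M.HasValueAt x w) : UnrSeries.HasValueAt (L + M) x (v + w) := by
  have h := HasSum.add hL hM
  unfold UnrSeries.HasValueAt
  convert h using 1
  funext k
  rw [map_add, Subring.coe_add, add_mul]

/-- Difference rule for values. [folklore] -/
theorem hasValueAt_sub {L M : UnrSeries p} {x v w : ℂ_[p]} (hL : L.HasValueAt x v)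
    (hM : M.HasValueAt x w) : UnrSeries.HasValueAt (L - M) x (v - w) := by
  have hfun : (fun k : ℕ ↦ ((coeff k (L - M) : unrIntegers p) : ℂ_[p]) * x ^ k) =
      fun k ↦ ((coeff k L : unrIntegers p) : ℂ_[p]) * x ^ k - ((coeff k M : unrIntegers p) : ℂ_[p]) * x ^ k := by
    funext k
    rw [map_sub, AddSubgroupClass.coe_sub, sub_mul]
  unfold UnrSeries.HasValueAt
  rw [hfun]
  exact hL.sub hM

/-- Power rule for values in the open unit disc. [folklore] -/
theorem hasValueAt_pow {L : UnrSeries p} {x v : ℂ_[p]} (hx : ‖x‖ < 1) (hL : L.HasValueAt x v)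
    (d : ℕ) : UnrSeries.HasValueAt (L ^ d) x (v ^ d) := by
  induction d with
  | zero => simpa using hasValueAt_one (p := p) x
  | succ k ih =>
    rw [pow_succ, pow_succ]
    exact hasValueAt_mul hx ih hL

/-- The `p`-power map `Φ = (1+T)^N − 1 ∈ R₀⟦T⟧` has the value `(1+x)^N − 1` at `x`, `‖x‖ < 1`. [folklore] -/
theorem hasValueAt_powerMap (N : ℕ) {x : ℂ_[p]} (hx : ‖x‖ < 1) :
    UnrSeries.HasValueAt ((1 + X : UnrSeries p) ^ N - 1) x ((1 + x) ^ N - 1) := by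
  have h1 : UnrSeries.HasValueAt (1 + X : UnrSeries p) x (1 + x) := by
    have hX := hasValueAt_X_pow (p := p) 1 x
    rw [pow_one, pow_one] at hX
    exact hasValueAt_add (hasValueAt_one x) hX
  exact hasValueAt_sub (hasValueAt_pow hx h1 N) (hasValueAt_one x)

/-- **Evaluation commutes with the `p`-power substitution**: if `𝓛` has the value `v` at
`(1+x)^N − 1` (`‖x‖ < 1`), then `𝓛((1+T)^N − 1)` has the value `v` at `x`
(b2b-bsdres `…Additive.hasSum_map_coeff_subst_mul_pow`). [cite: Washington1997, §7.2 (the p-power map)] -/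
theorem hasValueAt_subst_powerMap (N : ℕ) {L : UnrSeries p} {x v : ℂ_[p]} (hx : ‖x‖ < 1)
    (hL : L.HasValueAt ((1 + x) ^ N - 1) v) :
    UnrSeries.HasValueAt (L.subst ((1 + X : UnrSeries p) ^ N - 1)) x v := by
  have hA : ∀ k, ‖(unrIntegers p).subtype (coeff k L)‖ ≤ 1 := fun k ↦
    norm_coe_unrIntegers_le_one p (coeff k L)
  have hQ : ∀ k, ‖(unrIntegers p).subtype (coeff k ((1 + X : UnrSeries p) ^ N - 1))‖ ≤ 1 := fun k ↦
    norm_coe_unrIntegers_le_one p _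
  have hQ0 : constantCoeff ((1 + X : UnrSeries p) ^ N - 1) = 0 :=
    constantCoeff_one_add_X_pow_sub_one N
  have hw : HasSum (fun k ↦ (unrIntegers p).subtype (coeff k ((1 + X : UnrSeries p) ^ N - 1)) * x ^ k)
      ((1 + x) ^ N - 1) := hasValueAt_powerMap N hx
  have h := hasSum_map_coeff_subst_mul_pow (unrIntegers p).subtype hA hQ hQ0 hx hw
  have hv : ∑' k, (unrIntegers p).subtype (coeff k L) * ((1 + x) ^ N - 1) ^ k = v := hL.tsum_eq
  rw [hv] at h
  exact h

/-- Coefficient bound for the difference series. [folklore] -/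
theorem norm_coeff_C_mul_map_sub_map_le (θ : ℂ_[p]) (G₁ G₂ : UnrSeries p) (n : ℕ) :
    ‖coeff n (PowerSeries.C θ * PowerSeries.map (unrIntegers p).subtype G₁ -
      PowerSeries.map (unrIntegers p).subtype G₂)‖ ≤ max ‖θ‖ 1 := by
  rw [map_sub, coeff_C_mul, coeff_map, coeff_map]
  calc ‖θ * (unrIntegers p).subtype (coeff n G₁) - (unrIntegers p).subtype (coeff n G₂)‖
      ≤ max ‖θ * (unrIntegers p).subtype (coeff n G₁)‖ ‖(unrIntegers p).subtype (coeff n G₂)‖ := by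
        rw [sub_eq_add_neg, ← norm_neg ((unrIntegers p).subtype (coeff n G₂))]
        exact IsUltrametricDist.norm_add_le_max _ _
    _ ≤ max ‖θ‖ 1 := by
        apply max_le_max
        · rw [norm_mul]
          exact mul_le_of_le_one_right (norm_nonneg _) (norm_coe_unrIntegers_le_one p _)
        · exact norm_coe_unrIntegers_le_one p _

/-- **The abstract power-map identity.** Let `𝓛, 𝓛' ∈ R₀⟦T⟧`, `A, β ∈ ℂ_p`, and let `x_k` (`‖x_k‖ < 1`,
`x_k → 0`, `x_k ≠ 0`) be a sequence STABLE under the `p`-power map, `x_{k+1} = (1 + x_k)^p − 1`, with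
exponents `n_{k+1} = p · n_k`, such that `𝓛(x_k) = V_k` and `𝓛'(x_k) = A β^{n_k} V_k`. Then
`A^{p−1} · 𝓛'((1+T)^p−1) · 𝓛^p = 𝓛'^p · 𝓛((1+T)^p−1)` in `ℂ_p⟦T⟧` (both sides take the value
`A^p β^{p n_k} V_{k+1} V_k^p` at `x_k`; identity principle). [cite: Cassels1986, Ch. 4 Thm. 4.1 (identity principle, bounded variant)] -/
theorem powerMap_identity_of_values {L L' : UnrSeries p} {A β : ℂ_[p]} {x V : ℕ → ℂ_[p]} {n : ℕ → ℕ}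
    (hx1 : ∀ k, ‖x k‖ < 1) (hx0 : ∀ k, x k ≠ 0) (hx : Tendsto x atTop (𝓝 0))
    (hstep : ∀ k, x (k + 1) = (1 + x k) ^ p - 1) (hn : ∀ k, n (k + 1) = p * n k)
    (hV : ∀ k, L.HasValueAt (x k) (V k)) (hV' : ∀ k, L'.HasValueAt (x k) (A * β ^ n k * V k)) :
    PowerSeries.C (A ^ (p - 1)) *
        PowerSeries.map (unrIntegers p).subtype (L'.subst ((1 + X : UnrSeries p) ^ p - 1)) *
        PowerSeries.map (unrIntegers p).subtype L ^ p =
      PowerSeries.map (unrIntegers p).subtype L' ^ p *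
        PowerSeries.map (unrIntegers p).subtype (L.subst ((1 + X : UnrSeries p) ^ p - 1)) := by
  have hp1 : p - 1 + 1 = p := Nat.sub_add_cancel hp.out.one_le
  set G₁ : UnrSeries p := L'.subst ((1 + X : UnrSeries p) ^ p - 1) * L ^ p with hG₁
  set G₂ : UnrSeries p := L' ^ p * L.subst ((1 + X : UnrSeries p) ^ p - 1) with hG₂
  -- the difference series and its vanishing
  set G : PowerSeries ℂ_[p] := PowerSeries.C (A ^ (p - 1)) * PowerSeries.map (unrIntegers p).subtype G₁ -
    PowerSeries.map (unrIntegers p).subtype G₂ with hG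
  have hGzero : G = 0 := by
    refine powerSeries_eq_zero_of_hasSum_zero_of_tendsto_zero (φ := RingHom.id ℂ_[p])
      (fun _ _ h ↦ h) (C := max ‖A ^ (p - 1)‖ 1)
      (fun k ↦ by simpa [hG] using norm_coeff_C_mul_map_sub_map_le (A ^ (p - 1)) G₁ G₂ k)
      hx (Frequently.of_forall hx0) fun k ↦ ?_
    -- values of `G₁`, `G₂` at `x k`
    have h1 : UnrSeries.HasValueAt G₁ (x k) (A * β ^ n (k + 1) * V (k + 1) * V k ^ p) := by
      have ha : UnrSeries.HasValueAt (L'.subst ((1 + X : UnrSeries p) ^ p - 1)) (x k)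
          (A * β ^ n (k + 1) * V (k + 1)) := by
        apply hasValueAt_subst_powerMap p (hx1 k)
        rw [← hstep k]
        exact hV' (k + 1)
      exact hasValueAt_mul (hx1 k) ha (hasValueAt_pow (hx1 k) (hV k) p)
    have h2 : UnrSeries.HasValueAt G₂ (x k) ((A * β ^ n k * V k) ^ p * V (k + 1)) := by
      have hb : UnrSeries.HasValueAt (L.subst ((1 + X : UnrSeries p) ^ p - 1)) (x k) (V (k + 1)) := by
        apply hasValueAt_subst_powerMap p (hx1 k)
        rw [← hstep k]
        exact hV (k + 1)
      exact hasValueAt_mul (hx1 k) (hasValueAt_pow (hx1 k) (hV' k) p) hb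
    have h3 : HasSum (fun j ↦ coeff j G * x k ^ j)
        (A ^ (p - 1) * (A * β ^ n (k + 1) * V (k + 1) * V k ^ p) - (A * β ^ n k * V k) ^ p * V (k + 1)) := by
      have h12 := (HasSum.mul_left (A ^ (p - 1)) h1).sub h2
      have hfun : (fun j ↦ coeff j G * x k ^ j) = fun j ↦
          A ^ (p - 1) * (((coeff j G₁ : unrIntegers p) : ℂ_[p]) * x k ^ j) -
            ((coeff j G₂ : unrIntegers p) : ℂ_[p]) * x k ^ j := by
        funext j
        simp only [hG, map_sub, coeff_C_mul, coeff_map, Subring.coe_subtype]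
        ring
      rw [hfun]
      exact h12
    have hzero : A ^ (p - 1) * (A * β ^ n (k + 1) * V (k + 1) * V k ^ p) -
        (A * β ^ n k * V k) ^ p * V (k + 1) = 0 := by
      have hA : A ^ (p - 1) * A = A ^ p := by rw [← pow_succ, hp1]
      rw [hn k, pow_mul']
      calc A ^ (p - 1) * (A * (β ^ n k) ^ p * V (k + 1) * V k ^ p) - (A * β ^ n k * V k) ^ p * V (k + 1)
          = (A ^ (p - 1) * A) * (β ^ n k) ^ p * V (k + 1) * V k ^ p -
            (A * β ^ n k * V k) ^ p * V (k + 1) := by ring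
        _ = 0 := by rw [hA]; ring
    rw [hzero] at h3
    simpa only [RingHom.id_apply] using h3
  -- unfold `G = 0`
  have h := sub_eq_zero.mp hGzero
  simpa only [hG₁, hG₂, map_mul, map_pow, mul_assoc] using h

/-! ### §2 Two ♯-frames of the same `(ι, 𝔭, κ, γ, f)` -/

section Frame

variable {K : Type} [Field K] [NumberField K] {N : ℕ} {ι : PadicAlgCl p ≃+* ℂ}
  {𝔭 : HeightOneSpectrum (𝓞 K)} {κ : ZpExtension K p} {γ : Field.absoluteGaloisGroup K}
  {f : CuspForm (CongruenceSubgroup.Gamma0 N) 2} {ΩK ΩK' : ℂ} {Ωp Ωp' C C' : ℂ_[p]}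
  {L L' : UnrSeries p}

/-- **The power-type functional equation of two ♯-frames** (any prime `p`). If
`IsBDPLFunctionUpTo C ι 𝔭 κ γ f Ω_K Ω_p 𝓛` and `IsBDPLFunctionUpTo C' ι 𝔭 κ γ f Ω'_K Ω'_p 𝓛'` for the SAME
`(ι, 𝔭, κ, γ, f)` (`K` imaginary quadratic, `κ` anticyclotomic, `γ` a topological generator,
`Ω_K, Ω'_K, Ω_p, C ≠ 0`), then in `ℂ_p⟦T⟧`
`(C'/C)^{p−1} · 𝓛'((1+T)^p − 1) · 𝓛^p = 𝓛'^p · 𝓛((1+T)^p − 1)`.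
Proof: `powerMap_identity_of_values` along the supplied characters `φ_{k+K₀}` (types `m p^{k+K₀}`, points
`x₀^{p^{k+K₀}} − 1` in the open disc), with the values of `hL.hasValueAt` and `hasValueAt_frameUpTo_rescale`.
[cite: Castella2018, Thm. 3.1 (arXiv:1704.06608 p. 9)] -/
theorem powerMap_identity_of_isBDPLFunctionUpTo (hK : IsImaginaryQuadratic K) (hκ : κ.IsAnticyclotomic)
    (hγ : κ.IsTopGenerator γ) (hΩK : ΩK ≠ 0) (hΩK' : ΩK' ≠ 0) (hΩp : Ωp ≠ 0) (hC : C ≠ 0)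
    (hL : IsBDPLFunctionUpTo C ι 𝔭 κ γ f ΩK Ωp L) (hL' : IsBDPLFunctionUpTo C' ι 𝔭 κ γ f ΩK' Ωp' L') :
    PowerSeries.C ((C' / C) ^ (p - 1)) *
        PowerSeries.map (unrIntegers p).subtype (L'.subst ((1 + X : UnrSeries p) ^ p - 1)) *
        PowerSeries.map (unrIntegers p).subtype L ^ p =
      PowerSeries.map (unrIntegers p).subtype L' ^ p *
        PowerSeries.map (unrIntegers p).subtype (L.subst ((1 + X : UnrSeries p) ^ p - 1)) := by
  obtain ⟨m, x₀, φ, φ', r, r', hm, hx1, hx, hunr, hinf, hr, hrκ, hval, -, -, -, -, -⟩ :=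
    characterSupplyAt (p := p) K ι κ γ hK hκ hγ
  have hT0 : Tendsto (fun k ↦ x₀ ^ p ^ k - 1) atTop (𝓝 0) := by
    have := hx.sub_const 1
    simpa using this
  obtain ⟨K₀, hK₀⟩ : ∃ K₀, ∀ k ≥ K₀, ‖x₀ ^ p ^ k - 1‖ < 1 := by
    have hev : ∀ᶠ k in atTop, ‖x₀ ^ p ^ k - 1‖ < 1 := by
      have h := hT0.norm
      rw [norm_zero] at h
      exact h.eventually (gt_mem_nhds zero_lt_one)
    exact eventually_atTop.mp hev
  have hnpos : ∀ k, 0 < m * p ^ (k + K₀) := fun k ↦ Nat.mul_pos hm (pow_pos hp.out.pos _)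
  refine powerMap_identity_of_values (x := fun k ↦ x₀ ^ p ^ (k + K₀) - 1)
    (V := fun k ↦ C * (((ι.symm (bdpInterpolationValue p f 𝔭 (φ (k + K₀)) (m * p ^ (k + K₀)) ΩK) :
      PadicAlgCl p) : ℂ_[p]) * Ωp ^ (4 * (m * p ^ (k + K₀)))))
    (n := fun k ↦ m * p ^ (k + K₀)) (A := C' / C)
    (β := ((ι.symm ((ΩK / ΩK') ^ 4) : PadicAlgCl p) : ℂ_[p]) * (Ωp' / Ωp) ^ 4)
    (fun k ↦ hK₀ _ (Nat.le_add_left K₀ k)) (fun k ↦ sub_ne_zero.mpr (hx1 _))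
    (hT0.comp (tendsto_add_atTop_nat K₀)) (fun k ↦ ?_) (fun k ↦ ?_) (fun k ↦ ?_) (fun k ↦ ?_)
  · show x₀ ^ p ^ (k + 1 + K₀) - 1 = (1 + (x₀ ^ p ^ (k + K₀) - 1)) ^ p - 1
    have e : k + 1 + K₀ = k + K₀ + 1 := by omega
    rw [e, add_sub_cancel, ← pow_mul, ← pow_succ]
  · show m * p ^ (k + 1 + K₀) = p * (m * p ^ (k + K₀))
    have e : k + 1 + K₀ = k + K₀ + 1 := by omega
    rw [e, pow_succ]
    ring
  · have h := hL.hasValueAt (hnpos k) (hunr _) (hinf _) (hr _) (hrκ _)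
    rw [hval] at h
    exact h
  · have h := hasValueAt_frameUpTo_rescale hΩK hΩK' hΩp hC hL' (hnpos k) (hunr (k + K₀)) (hinf _)
      (hr _) (hrκ _)
    rw [hval] at h
    exact h

end Frame

end Summit.BirchSwinnertonDyer.BirchSwinnertonDyer.Theorems.CongruentShaFreeCutBDPUpToPowerMapIdentity

end
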